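import Mathlib
import HarnessLib
import Summits.Ventures.LatticeQCDFlow.Exactness.NCMCGeneralSpaceOccupancy

/-!
# The stationary switch rate of the expanded ensemble and its throttling by a mistuned level constant

HONEST FRAMING: exact (Metropolis-corrected) sampling algorithms for lattice gauge theory;
figures of merit are autocorrelation/cost numbers at stated couplings and volumes; no
continuum-physics claim.

Venture `LatticeQCDFlow` (cell pub-lqcd), topic `Exactness`; FANOUT row 13 (`eng-snf`, GEN-12).
NEW WORK of the cell (elementary), not a published result; nothing is cited as a fact.  Corollaries
of `NCMCGeneralSpaceOccupancy.lean` (GEN-11: occupancy law `p(c) = σ(c − ΔF)` and flow balance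
`(1 − p) a_F(c) = p a_R(c)`) listed there as a natural continuation ("the overall switch acceptance
in stationarity = 2(1 − p)·a_F(c)").

## Setting and content

A Crooks pair from `ν₀` to `ν₁`, a level constant `c`; `p = p(c)` the stationary occupancy of the
target level (`jointWeight c ν₀ ν₁ (targetLevel Ω) / jointWeight c ν₀ ν₁ univ`), `a_F(c) =
E_{P_F}[min(1, e^{−(W−c)})]` and `a_R(c) = E_{P_R}[min(1, e^{W−c})]` the two lanes' mean acceptances.
In stationarity a switch proposal is made from the prior level with probability `1 − p` and from
the target level with probability `p`, so the long-run fraction of ACCEPTED switch proposals is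
`rate(c) = (1 − p) a_F(c) + p a_R(c)`.

* `integral_accept_le_one`, `integral_accept_rev_le_one` — `a_F(c), a_R(c) ≤ 1`.
* **`CrooksPair.switchRate_eq_two_mul`** / `…_eq_two_mul_rev` — `rate(c) = 2 (1 − p) a_F(c) = 2 p a_R(c)`
  (flow balance).
* **`CrooksPair.switchRate_le_two_mul_min`** — `rate(c) ≤ 2 min(p, 1 − p)`: whatever the protocol,
  the stationary switch rate is capped by twice the minority level's occupancy;
  **`CrooksPair.switchRate_le_two_mul_sigmoid`** — with `e^{−ΔF} = Z₁/Z₀`: `rate(c) ≤ 2 σ(−|c − ΔF|)`,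
  i.e. a level constant mistuned by `|c − ΔF|` throttles switching below `2σ(−|c − ΔF|)` (e.g. below
  `0.54` at `|c − ΔF| = 1`, below `0.095` at `3`) — the population reason the engine re-tunes `ncmc.c`
  from a pilot (`ncmc.c_from_works`, BAR root = ΔF, `NCMCGeneralSpaceBennettRoot.lean`).
* **`CrooksPair.switchRate_freeEnergyDiff`** — at `c = ΔF`: `p = ½` and `rate = a_F(ΔF)`, the overlap
  acceptance `1 − TV(P_F, P_R)` of `NCMCGeneralSpaceOverlap.lean`.

Nothing is claimed about which `c` maximises the rate for a given pair (that depends on the two work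
laws), nor about any value for a concrete protocol.
-/

namespace Summit.Ventures.LatticeQCDFlow.Exactness.GeneralNCMC

open MeasureTheory ProbabilityTheory Set Filter
open scoped ENNReal

variable {Ω E : Type*} [MeasurableSpace Ω] [MeasurableSpace E]

/-- A mean acceptance is at most one: `E_μ[min(1, e^{−(W−c)})] ≤ 1` on a probability law. -/
theorem integral_accept_le_one (μ : Measure E) [IsProbabilityMeasure μ] (W : E → ℝ) (c : ℝ) :
    ∫ ε, min 1 (Real.exp (-(W ε - c))) ∂μ ≤ 1 := by
  have h := integral_mono_of_nonneg (μ := μ) (f := fun ε => min 1 (Real.exp (-(W ε - c))))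
    (g := fun _ => (1 : ℝ)) (Eventually.of_forall fun ε => le_min zero_le_one (Real.exp_pos _).le)
    (integrable_const 1) (Eventually.of_forall fun ε => min_le_left _ _)
  simpa using h

/-- The reverse lane's mean acceptance is at most one: `E_μ[min(1, e^{W−c})] ≤ 1`. -/
theorem integral_accept_rev_le_one (μ : Measure E) [IsProbabilityMeasure μ] (W : E → ℝ) (c : ℝ) :
    ∫ ε, min 1 (Real.exp (W ε - c)) ∂μ ≤ 1 := by
  have h := integral_mono_of_nonneg (μ := μ) (f := fun ε => min 1 (Real.exp (W ε - c)))
    (g := fun _ => (1 : ℝ)) (Eventually.of_forall fun ε => le_min zero_le_one (Real.exp_pos _).le)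
    (integrable_const 1) (Eventually.of_forall fun ε => min_le_left _ _)
  simpa using h

namespace CrooksPair

variable {ν₀ ν₁ : Measure Ω} {κF κR : Kernel Ω E} {s e : E → Ω} {W : E → ℝ}

/-- **The stationary switch rate is twice the accepted up-flow**:
`(1 − p) a_F(c) + p a_R(c) = 2 (1 − p) a_F(c)`. -/
theorem switchRate_eq_two_mul [IsFiniteMeasure ν₀] [IsFiniteMeasure ν₁] [IsMarkovKernel κF]
    [IsMarkovKernel κR] (h0 : ν₀ univ ≠ 0) (h1 : ν₁ univ ≠ 0) (h : CrooksPair ν₀ ν₁ κF κR s e W)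
    (c : ℝ) :
    (1 - (jointWeight c ν₀ ν₁ (targetLevel Ω)).toReal / (jointWeight c ν₀ ν₁ univ).toReal) *
          ∫ ε, min 1 (Real.exp (-(W ε - c))) ∂(fwdPathLaw ν₀ κF) +
        (jointWeight c ν₀ ν₁ (targetLevel Ω)).toReal / (jointWeight c ν₀ ν₁ univ).toReal *
          ∫ ε, min 1 (Real.exp (W ε - c)) ∂(fwdPathLaw ν₁ κR) =
      2 * ((1 - (jointWeight c ν₀ ν₁ (targetLevel Ω)).toReal / (jointWeight c ν₀ ν₁ univ).toReal) *
        ∫ ε, min 1 (Real.exp (-(W ε - c))) ∂(fwdPathLaw ν₀ κF)) := by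
  rw [← h.one_sub_occupancy_mul_accept_eq h0 h1 c]
  ring

/-- … and twice the accepted down-flow: `(1 − p) a_F(c) + p a_R(c) = 2 p a_R(c)`. -/
theorem switchRate_eq_two_mul_rev [IsFiniteMeasure ν₀] [IsFiniteMeasure ν₁] [IsMarkovKernel κF]
    [IsMarkovKernel κR] (h0 : ν₀ univ ≠ 0) (h1 : ν₁ univ ≠ 0) (h : CrooksPair ν₀ ν₁ κF κR s e W)
    (c : ℝ) :
    (1 - (jointWeight c ν₀ ν₁ (targetLevel Ω)).toReal / (jointWeight c ν₀ ν₁ univ).toReal) *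
          ∫ ε, min 1 (Real.exp (-(W ε - c))) ∂(fwdPathLaw ν₀ κF) +
        (jointWeight c ν₀ ν₁ (targetLevel Ω)).toReal / (jointWeight c ν₀ ν₁ univ).toReal *
          ∫ ε, min 1 (Real.exp (W ε - c)) ∂(fwdPathLaw ν₁ κR) =
      2 * ((jointWeight c ν₀ ν₁ (targetLevel Ω)).toReal / (jointWeight c ν₀ ν₁ univ).toReal *
        ∫ ε, min 1 (Real.exp (W ε - c)) ∂(fwdPathLaw ν₁ κR)) := by
  rw [h.one_sub_occupancy_mul_accept_eq h0 h1 c]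
  ring

/-- **The switch rate is capped by twice the minority occupancy**: `rate(c) ≤ 2 min(p, 1 − p)`. -/
theorem switchRate_le_two_mul_min [IsFiniteMeasure ν₀] [IsFiniteMeasure ν₁] [IsMarkovKernel κF]
    [IsMarkovKernel κR] (h0 : ν₀ univ ≠ 0) (h1 : ν₁ univ ≠ 0) (h : CrooksPair ν₀ ν₁ κF κR s e W)
    (c : ℝ) :
    (1 - (jointWeight c ν₀ ν₁ (targetLevel Ω)).toReal / (jointWeight c ν₀ ν₁ univ).toReal) *
          ∫ ε, min 1 (Real.exp (-(W ε - c))) ∂(fwdPathLaw ν₀ κF) +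
        (jointWeight c ν₀ ν₁ (targetLevel Ω)).toReal / (jointWeight c ν₀ ν₁ univ).toReal *
          ∫ ε, min 1 (Real.exp (W ε - c)) ∂(fwdPathLaw ν₁ κR) ≤
      2 * min ((jointWeight c ν₀ ν₁ (targetLevel Ω)).toReal / (jointWeight c ν₀ ν₁ univ).toReal)
        (1 - (jointWeight c ν₀ ν₁ (targetLevel Ω)).toReal / (jointWeight c ν₀ ν₁ univ).toReal) := by
  haveI := isProbabilityMeasure_fwdPathLaw ν₀ h0 κF
  haveI := isProbabilityMeasure_fwdPathLaw ν₁ h1 κR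
  set p := (jointWeight c ν₀ ν₁ (targetLevel Ω)).toReal / (jointWeight c ν₀ ν₁ univ).toReal with hp
  have hz0 : 0 < (ν₀ univ).toReal := ENNReal.toReal_pos h0 (measure_ne_top ν₀ univ)
  have hz1 : 0 < (ν₁ univ).toReal := ENNReal.toReal_pos h1 (measure_ne_top ν₁ univ)
  have hp0 : 0 ≤ p := by
    rw [hp, toReal_jointWeight_targetLevel, toReal_jointWeight_univ]
    positivity
  have hp1 : p ≤ 1 := by
    rw [hp, toReal_jointWeight_targetLevel, toReal_jointWeight_univ,
      div_le_one (by positivity)]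
    linarith
  have haF := integral_accept_le_one (fwdPathLaw ν₀ κF) W c
  have haR := integral_accept_rev_le_one (fwdPathLaw ν₁ κR) W c
  have haF0 : 0 ≤ ∫ ε, min 1 (Real.exp (-(W ε - c))) ∂(fwdPathLaw ν₀ κF) :=
    integral_nonneg fun ε => le_min zero_le_one (Real.exp_pos _).le
  have haR0 : 0 ≤ ∫ ε, min 1 (Real.exp (W ε - c)) ∂(fwdPathLaw ν₁ κR) :=
    integral_nonneg fun ε => le_min zero_le_one (Real.exp_pos _).le
  have hup := h.switchRate_eq_two_mul h0 h1 c
  have hdown := h.switchRate_eq_two_mul_rev h0 h1 c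
  rcases le_total p (1 - p) with hle | hle
  · rw [min_eq_left hle, hdown]
    nlinarith [mul_le_mul_of_nonneg_left haR hp0]
  · rw [min_eq_right hle, hup]
    have h1p : 0 ≤ 1 - p := by linarith
    nlinarith [mul_le_mul_of_nonneg_left haF h1p]

/-- **Throttling by a mistuned level constant**: with `e^{−ΔF} = Z₁/Z₀`,
`rate(c) ≤ 2 σ(−|c − ΔF|)` (`p = σ(c − ΔF)`, `min(σ(x), 1 − σ(x)) = σ(−|x|)`). -/
theorem switchRate_le_two_mul_sigmoid [IsFiniteMeasure ν₀] [IsFiniteMeasure ν₁] [IsMarkovKernel κF]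
    [IsMarkovKernel κR] (h0 : ν₀ univ ≠ 0) (h1 : ν₁ univ ≠ 0) (h : CrooksPair ν₀ ν₁ κF κR s e W)
    (c : ℝ) {ΔF : ℝ} (hΔF : Real.exp (-ΔF) = ((ν₀ univ)⁻¹ * ν₁ univ).toReal) :
    (1 - (jointWeight c ν₀ ν₁ (targetLevel Ω)).toReal / (jointWeight c ν₀ ν₁ univ).toReal) *
          ∫ ε, min 1 (Real.exp (-(W ε - c))) ∂(fwdPathLaw ν₀ κF) +
        (jointWeight c ν₀ ν₁ (targetLevel Ω)).toReal / (jointWeight c ν₀ ν₁ univ).toReal *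
          ∫ ε, min 1 (Real.exp (W ε - c)) ∂(fwdPathLaw ν₁ κR) ≤
      2 * Real.sigmoid (-|c - ΔF|) := by
  have hmin := h.switchRate_le_two_mul_min h0 h1 c
  rw [occupancy_eq_sigmoid c ν₀ ν₁ h0 h1 hΔF] at hmin ⊢
  refine hmin.trans (le_of_eq ?_)
  congr 1
  rcases le_or_gt 0 (c - ΔF) with hx | hx
  · rw [abs_of_nonneg hx, min_eq_right, Real.sigmoid_neg]
    have := Real.sigmoid_monotone (neg_le_self hx)
    rw [Real.sigmoid_neg] at this
    linarith
  · rw [abs_of_neg hx, neg_neg, min_eq_left]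
    have := Real.sigmoid_monotone (le_of_lt (lt_trans hx (neg_pos.2 hx)))
    rw [Real.sigmoid_neg] at this
    linarith

/-- **At `c = ΔF` the two levels are equally occupied and the switch rate is the overlap acceptance**:
`rate(ΔF) = a_F(ΔF)` (`= 1 − TV(P_F, P_R)`, `NCMCGeneralSpaceOverlap.lean`). -/
theorem switchRate_freeEnergyDiff [IsFiniteMeasure ν₀] [IsFiniteMeasure ν₁] [IsMarkovKernel κF]
    [IsMarkovKernel κR] (h0 : ν₀ univ ≠ 0) (h1 : ν₁ univ ≠ 0) (h : CrooksPair ν₀ ν₁ κF κR s e W)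
    {ΔF : ℝ} (hΔF : Real.exp (-ΔF) = ((ν₀ univ)⁻¹ * ν₁ univ).toReal) :
    (1 - (jointWeight ΔF ν₀ ν₁ (targetLevel Ω)).toReal / (jointWeight ΔF ν₀ ν₁ univ).toReal) *
          ∫ ε, min 1 (Real.exp (-(W ε - ΔF))) ∂(fwdPathLaw ν₀ κF) +
        (jointWeight ΔF ν₀ ν₁ (targetLevel Ω)).toReal / (jointWeight ΔF ν₀ ν₁ univ).toReal *
          ∫ ε, min 1 (Real.exp (W ε - ΔF)) ∂(fwdPathLaw ν₁ κR) =
      ∫ ε, min 1 (Real.exp (-(W ε - ΔF))) ∂(fwdPathLaw ν₀ κF) := by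
  rw [h.switchRate_eq_two_mul h0 h1 ΔF, (occupancy_eq_half_iff ΔF ν₀ ν₁ h0 h1 hΔF).2 rfl]
  ring

end CrooksPair

end Summit.Ventures.LatticeQCDFlow.Exactness.GeneralNCMC
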